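import Mathlib
import Summits.CriticalPhenomena.CardyFormulaZ2.Theorems.CardySelfRefinementGradientComparabilityStubBulkPivotalSumDivergesTemplate
import Summits.CriticalPhenomena.CardyFormulaZ2.Theorems.CardySelfRefinementGradientComparabilityStubBulkPivotalSumDivergesSmall
import HarnessLib

/-!
# The bulk pivotal count diverges, given non-degeneracy of the crossing event given the layer

Crux `stmt-CriticalPhenomena-10269`
(`Summit.CriticalPhenomena.CardyFormulaZ2.Theses.CardySelfRefinement.GradientComparability`),
line **Sketch**, helper file of the stub `stub_bulkPivotalSum_diverges` (D3-bulk).  Vocabulary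
(`Aloc`, `window`) from `CardySelfRefinementDefs`; the one-cut inequality `percut_mean` from
`…StubBulkPivotalSumDivergesTemplate`, the smallness of section influences
`section_pivotal_uniformly_small` from `…StubBulkPivotalSumDivergesSmall`.

## Mathematics

**Theorem (`bulkPivotalSum_diverges_of_condVariance`, registered sub-goal).**  Let `F` be a
nonempty finite quad family and suppose that the joint crossing event is NON-DEGENERATE GIVEN THE
BOUNDARY LAYER: there are `v₀, r_C, η_C > 0` such that for every mesh `η < η_C` and every set `L` of
window edges all having an endpoint at drawn distance `< r_C` from `∂F = ⋃ᵢ ∂(F i)`, the conditional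
variance `Σ_{ξ ⊆ L} P(ω ∩ L = ξ) t_ξ(1 − t_ξ)` (`t_ξ = P((ω ∖ L) ∪ ξ ∈ Aloc)`) is at least `v₀`.
Then for every `N` and all small `η`, the sum of `P_{1/2}(e pivotal for Aloc)` over the bulk edges
(window edges at drawn distance `≥ r_C/2` from `∂F`) is at least `N`.

*Proof (many cuts).*  Put `N' = N/v₀`, `ψ = 2v₀e^{−4N'/v₀}`, `K ≥ 2N/(ψv₀)`, `ρ' = r_C/(2K)`,
`π = ψ/(2N')`, and cut at the radii `θ_k = r_C/2 + kρ'`, `k < K`: bulk `B_k` = window edges at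
distance `≥ θ_k` from `∂F`, layer `L_k = W ∖ B_k` (inside the `r_C`-layer), `near_k = B_k ∖ B_{k+1}`.
An edge of `B_{k+1}` is `ρ'`-far from `L_k` (triangle inequality), so its section influences are
`≤ π` for small `η` (`section_pivotal_uniformly_small`), and `percut_mean` gives
`2v₀ ≤ g(θ_k)/N' + (2/ψ)(g(θ_k) − g(θ_{k+1}))` with `g(θ) = Σ_{dist ≥ θ} P(e pivotal)`.  Summing the
`K` inequalities, the telescoping sum is `≤ g(θ₀)` and each `g(θ_k) ≤ g(θ₀)`, whence
`2Kv₀ ≤ (K/N' + 2/ψ) g(θ₀) ≤ (2Kv₀/N) g(θ₀)`, i.e. `N ≤ g(θ₀) = Σ_{bulk} P(e pivotal)`.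
-/

noncomputable section

namespace Summit.CriticalPhenomena.CardyFormulaZ2.Theorems.CardySelfRefinement

open scoped Topology
open Filter Set MeasureTheory
open Literature.Probability.LatticeModels Literature.Probability.Percolation
open Literature.Probability.Percolation.QuadCrossing
open Summit.CriticalPhenomena.CardyFormulaZ2.Theses.CardySelfRefinement

/-- **The bulk pivotal count diverges, given non-degeneracy of the joint crossing event given the
boundary layer** (many cuts ⨉ `percut_mean` ⨉ `section_pivotal_uniformly_small`). -/
theorem bulkPivotalSum_diverges_of_condVariance (m : ℕ) (F : Fin m → Quad (Set.univ : Set ℂ))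
    (hm : 0 < m) {v₀ rC ηC : ℝ} (hv₀ : 0 < v₀) (hrC : 0 < rC) (hηC : 0 < ηC)
    (hC : ∀ η ∈ Set.Ioo 0 ηC, ∀ W L : Finset (Sym2 (Site 2)),
      (↑W : Set (Sym2 (Site 2))) = window m F η → L ⊆ W →
      (∀ f ∈ L, ∃ y ∈ f, ∃ (i : Fin m) (j : Fin 4), ∃ p ∈ (F i).side j,
        dist ((η : ℂ) * squareLatticeEmbedding.z y) p < rC) →
      v₀ ≤ ∑ ξ ∈ L.powerset, (bondPercolation (zdGraph 2) half).real {ω | obs ω L = ξ} *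
        ((bondPercolation (zdGraph 2) half).real
            {ω' : BondConfig (Site 2) | ω' \ ↑L ∪ ↑ξ ∈ Aloc m F η} *
          (1 - (bondPercolation (zdGraph 2) half).real
            {ω' : BondConfig (Site 2) | ω' \ ↑L ∪ ↑ξ ∈ Aloc m F η}))) :
    ∀ N : ℝ, ∃ η₁ : ℝ, 0 < η₁ ∧ ∀ η ∈ Set.Ioo 0 η₁, ∀ Wb : Finset (Sym2 (Site 2)),
      (↑Wb : Set (Sym2 (Site 2))) = {e ∈ window m F η | ∀ x ∈ e, ∀ (i : Fin m) (j : Fin 4),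
        ∀ p ∈ (F i).side j, rC / 2 ≤ dist ((η : ℂ) * squareLatticeEmbedding.z x) p} →
      N ≤ ∑ e ∈ Wb, (bondPercolation (zdGraph 2) half).real {ω | IsPivotal (Aloc m F η) e ω} := by
  classical
  intro N
  by_cases hN : N ≤ 0
  · exact ⟨ηC, hηC, fun η hη Wb hWb => hN.trans (Finset.sum_nonneg fun e _ => measureReal_nonneg)⟩
  rw [not_le] at hN
  -- the constants
  set N' : ℝ := N / v₀ with hN'def
  have hN' : 0 < N' := div_pos hN hv₀
  set ψ : ℝ := 4 * (v₀ / 2) * Real.exp (-(2 * N' / (v₀ / 2))) with hψdef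
  have hψ : 0 < ψ := by positivity
  set π : ℝ := ψ / (2 * N') with hπdef
  have hπ0 : 0 < π := by positivity
  have hπN' : π * N' = ψ / 2 := by rw [hπdef]; field_simp
  have hπN : π * N' < ψ := by rw [hπN']; linarith
  have hc : 1 / (ψ - π * N') = 2 / ψ := by rw [hπN']; field_simp; ring
  obtain ⟨K, hK, hK1⟩ : ∃ K : ℕ, 2 * N / (ψ * v₀) ≤ K ∧ 1 ≤ K :=
    ⟨⌈2 * N / (ψ * v₀)⌉₊ + 1, (Nat.le_ceil _).trans (by exact_mod_cast Nat.le_succ _),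
      Nat.le_add_left 1 _⟩
  have hKpos : (0 : ℝ) < K := by exact_mod_cast hK1
  set ρ' : ℝ := rC / 2 / K with hρ'def
  have hρ' : 0 < ρ' := by positivity
  obtain ⟨ηs, hηs, hsmall⟩ := section_pivotal_uniformly_small m F hm ρ' hρ' π hπ0
  refine ⟨min ηC ηs, lt_min hηC hηs, fun η hη Wb hWb => ?_⟩
  have hη0 : 0 < η := hη.1
  have hηC' : η ∈ Set.Ioo 0 ηC := ⟨hη.1, lt_of_lt_of_le hη.2 (min_le_left _ _)⟩
  have hηs' : η ∈ Set.Ioo 0 ηs := ⟨hη.1, lt_of_lt_of_le hη.2 (min_le_right _ _)⟩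
  set μ := bondPercolation (zdGraph 2) half with hμ
  -- the window and the bulk sets `B k` beyond the radii `θ k = rC/2 + k ρ'`
  set W : Finset (Sym2 (Site 2)) := (window_finite m F hη0.ne').toFinset with hWdef
  have hW : (↑W : Set (Sym2 (Site 2))) = window m F η := Set.Finite.coe_toFinset _
  set θ : ℕ → ℝ := fun k => rC / 2 + k * ρ' with hθ
  have hθmono : ∀ k k' : ℕ, k ≤ k' → θ k ≤ θ k' := fun k k' hkk' => by
    simp only [hθ]
    have : (k : ℝ) ≤ k' := by exact_mod_cast hkk'
    nlinarith
  have hθK : ∀ k : ℕ, k ≤ K → θ k ≤ rC := fun k hk => by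
    have h1 := hθmono k K hk
    have h2 : θ K = rC := by
      simp only [hθ, hρ'def]
      field_simp
      ring
    linarith
  have hθsucc : ∀ k : ℕ, θ (k + 1) = θ k + ρ' := fun k => by
    simp only [hθ, Nat.cast_add, Nat.cast_one]; ring
  set B : ℕ → Finset (Sym2 (Site 2)) := fun k => W.filter (fun e => ∀ x ∈ e,
    ∀ (i : Fin m) (j : Fin 4), ∀ p ∈ (F i).side j,
      θ k ≤ dist ((η : ℂ) * squareLatticeEmbedding.z x) p) with hB
  have hBW : ∀ k, B k ⊆ W := fun k e he => (Finset.mem_filter.1 he).1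
  have hBanti : ∀ k k' : ℕ, k ≤ k' → B k' ⊆ B k := fun k k' hkk' e he => by
    rw [Finset.mem_filter] at he ⊢
    exact ⟨he.1, fun x hx i j p hp => (hθmono k k' hkk').trans (he.2 x hx i j p hp)⟩
  have hB0 : B 0 = Wb := by
    ext e
    have h1 := Set.ext_iff.1 hWb e
    simp only [Finset.mem_coe, Set.mem_setOf_eq] at h1
    rw [h1, Finset.mem_filter, ← Finset.mem_coe, hW]
    simp only [hθ, Nat.cast_zero, zero_mul, add_zero]
  set g : ℕ → ℝ := fun k => ∑ e ∈ B k, μ.real {ω | IsPivotal (Aloc m F η) e ω} with hg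
  have hg_nn : ∀ k, 0 ≤ g k := fun k => Finset.sum_nonneg fun e _ => measureReal_nonneg
  have hg_le : ∀ k, g k ≤ g 0 := fun k =>
    Finset.sum_le_sum_of_subset_of_nonneg (hBanti 0 k (Nat.zero_le k))
      fun e _ _ => measureReal_nonneg
  -- one cut at each radius `θ k`, `k < K`
  have hcut : ∀ k, k < K → 2 * v₀ ≤ 1 / N' * g k + 2 / ψ * (g k - g (k + 1)) := by
    intro k hk
    have hnear : B k \ B (k + 1) ⊆ W \ (W \ B k) := by
      rw [sdiff_sdiff_eq_self (hBW k)]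
      exact Finset.sdiff_subset
    have hlayer : ∀ f ∈ W \ B k, ∃ y ∈ f, ∃ (i : Fin m) (j : Fin 4), ∃ p ∈ (F i).side j,
        dist ((η : ℂ) * squareLatticeEmbedding.z y) p < θ k := by
      intro f hf
      rw [Finset.mem_sdiff, Finset.mem_filter] at hf
      obtain ⟨hfW, hfB⟩ := hf
      by_contra hcon
      push Not at hcon
      exact hfB ⟨hfW, fun x hx i j p hp => hcon x hx i j p hp⟩
    have hmean := hC η hηC' W (W \ B k) hW Finset.sdiff_subset fun f hf => by
      obtain ⟨y, hy, i, j, p, hp, hd⟩ := hlayer f hf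
      exact ⟨y, hy, i, j, p, hp, lt_of_lt_of_le hd (hθK k hk.le)⟩
    have hsm : ∀ ξ ∈ (W \ B k).powerset, ∀ e ∈ (W \ (W \ B k)) \ (B k \ B (k + 1)),
        μ.real {ω | IsPivotal {ω' : BondConfig (Site 2) |
          ω' \ ↑(W \ B k) ∪ ↑ξ ∈ Aloc m F η} e ω} ≤ π := by
      intro ξ hξ e he
      rw [sdiff_sdiff_eq_self (hBW k), Finset.mem_sdiff, Finset.mem_sdiff] at he
      obtain ⟨heB, he'⟩ := he
      have heB1 : e ∈ B (k + 1) := by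
        by_contra hcon
        exact he' ⟨heB, hcon⟩
      refine hsmall η hηs' (W \ B k) ξ (Finset.mem_powerset.1 hξ) e
        (fun h => (Finset.mem_sdiff.1 h).2 heB) fun f hf => ?_
      obtain ⟨y, hy, i, j, p, hp, hd⟩ := hlayer f hf
      refine ⟨y, hy, fun x hx => ?_⟩
      have hx' := (Finset.mem_filter.1 heB1).2 x hx i j p hp
      rw [hθsucc] at hx'
      linarith [dist_triangle ((η : ℂ) * squareLatticeEmbedding.z x)
        ((η : ℂ) * squareLatticeEmbedding.z y) p]
    have h := percut_mean m F hη0.ne' hW hnear hπ0.le hv₀ hN' hπN hsm hmean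
    rw [sdiff_sdiff_eq_self (hBW k), Finset.sum_sdiff_eq_sub (hBanti k (k + 1) (Nat.le_succ k)),
      hc] at h
    exact h
  -- sum the `K` cuts
  have hKsum : (K : ℝ) * (2 * v₀) ≤ (K : ℝ) * (1 / N') * g 0 + 2 / ψ * g 0 := by
    calc (K : ℝ) * (2 * v₀) = ∑ _k ∈ Finset.range K, 2 * v₀ := by
          rw [Finset.sum_const, Finset.card_range, nsmul_eq_mul]
      _ ≤ ∑ k ∈ Finset.range K, (1 / N' * g k + 2 / ψ * (g k - g (k + 1))) :=
          Finset.sum_le_sum fun k hk => hcut k (Finset.mem_range.1 hk)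
      _ = 1 / N' * ∑ k ∈ Finset.range K, g k + 2 / ψ * ∑ k ∈ Finset.range K, (g k - g (k + 1)) := by
          rw [Finset.sum_add_distrib, Finset.mul_sum, Finset.mul_sum]
      _ = 1 / N' * ∑ k ∈ Finset.range K, g k + 2 / ψ * (g 0 - g K) := by
          rw [Finset.sum_range_sub']
      _ ≤ 1 / N' * ∑ _k ∈ Finset.range K, g 0 + 2 / ψ * g 0 := by
          gcongr with k hk
          · exact hg_le k
          · linarith [hg_nn K]
      _ = (K : ℝ) * (1 / N') * g 0 + 2 / ψ * g 0 := by
          rw [Finset.sum_const, Finset.card_range, nsmul_eq_mul]; ring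
  -- conclude
  have h1 : (K : ℝ) * (1 / N') = K * v₀ / N := by rw [hN'def]; field_simp
  have h2 : 2 / ψ ≤ K * v₀ / N := by
    rw [div_le_div_iff₀ hψ hN]
    have := (div_le_iff₀ (by positivity : 0 < ψ * v₀)).1 hK
    nlinarith
  have h3 : (K : ℝ) * (2 * v₀) ≤ 2 * (K * v₀ / N) * g 0 := by
    nlinarith [hg_nn 0, mul_le_mul_of_nonneg_right h2 (hg_nn 0)]
  have h4 : N ≤ g 0 := by
    by_contra hcon
    rw [not_le] at hcon
    have : 2 * (K * v₀ / N) * g 0 < 2 * (K * v₀ / N) * N := by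
      apply mul_lt_mul_of_pos_left hcon
      positivity
    rw [show 2 * ((K : ℝ) * v₀ / N) * N = K * (2 * v₀) by field_simp] at this
    linarith
  calc N ≤ g 0 := h4
    _ = ∑ e ∈ Wb, μ.real {ω | IsPivotal (Aloc m F η) e ω} := by simp only [hg, hB0]

end Summit.CriticalPhenomena.CardyFormulaZ2.Theorems.CardySelfRefinement

end
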